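import Literature.MathematicalPhysics.KineticTheory.TrigPolyBracket
import HarnessLib

/-!
# Locality and smoothness bookkeeping for symbolic trigonometric polynomials

`Literature/MathematicalPhysics/KineticTheory/` — continuation of `TrigPoly.lean` /
`TrigPolyBracket.lean` (the class `𝒮(Ω)` of W. De Roeck, F. Huveneers, CPAM 68 (2015),
arXiv:1305.5127, §3.1). Two invariants of a trigonometric polynomial are propagated through the
operators of the perturbative scheme:

* SUPPORT (`TrigTerm.SuppWithin t r`, §3.1 (3.2): "`∂f_x/∂q_y = ∂f_x/∂ω_y = 0` if `|x - y| > r(f)`";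
  coefficients `DependsOn` the site ball — closure lemmas for Mathlib's `DependsOn` under `+,·,∂` are
  dot-notation extensions declared here):
  preserved by `smulFun` with a local multiplier, by `L_D`, `𝓡`, `L_D⁻¹(Id - 𝓡)` ("`r(L_D⁻¹(Id - 𝓡)f) = r(f)`",
  §3.3), and raised to `r' + 2r` by the bracket (`SuppWithin.bracket`: "`r(L_g f) ≤ 2r(g) + r(f)`",
  §3.3 proof of (3.11)); polynomial versions `TrigPoly.SuppWithinAll`.
* SMOOTHNESS of the coefficients at a scale `δ` (`TrigPoly.SmoothAt`): preserved by all operators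
  (`L_D⁻¹(Id - 𝓡)` needs the divided cut-off `(1 - ρ(s/δ))/s` to be smooth, `contDiff_cutDiv`, which
  holds for `ρ` smooth and `= 1` near `0`; at `δ = 0` it is the zero function).

Together (`TrigPoly.Good r δ`) they give the admissibility required by
`TrigPoly.poisson_ev_ev`, stable under iterated brackets. No named facts.
-/

noncomputable section

open Function Set Finset Filter
open scoped ContDiff BigOperators Topology

namespace Literature.MathematicalPhysics.KineticTheory.HeatConduction

variable {m : ℕ}

namespace TrigTerm

end TrigTerm

/-! ### Closure properties of `DependsOn` (dot-notation extensions of Mathlib's `DependsOn`) -/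

section Depends

variable {ι : Type*} {s : Set ι} {g g' : (ι → ℝ) → ℝ}

/-- Products (dot-notation extension of Mathlib's `DependsOn`). [folklore] -/
theorem _root_.DependsOn.mul (hg : DependsOn g s) (hg' : DependsOn g' s) : DependsOn (fun w => g w * g' w) s :=
  fun _ _ h => by simp only [hg h, hg' h]

/-- Sums (dot-notation extension of Mathlib's `DependsOn`). [folklore] -/
theorem _root_.DependsOn.add (hg : DependsOn g s) (hg' : DependsOn g' s) : DependsOn (fun w => g w + g' w) s :=
  fun _ _ h => by simp only [hg h, hg' h]

/-- Differences (dot-notation extension of Mathlib's `DependsOn`). [folklore] -/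
theorem _root_.DependsOn.sub (hg : DependsOn g s) (hg' : DependsOn g' s) : DependsOn (fun w => g w - g' w) s :=
  fun _ _ h => by simp only [hg h, hg' h]

/-- Negatives (dot-notation extension of Mathlib's `DependsOn`). [folklore] -/
theorem _root_.DependsOn.neg (hg : DependsOn g s) : DependsOn (fun w => -g w) s :=
  fun _ _ h => by simp only [hg h]

/-- Division by a constant (dot-notation extension of Mathlib's `DependsOn`). [folklore] -/
theorem _root_.DependsOn.div_const (hg : DependsOn g s) (c : ℝ) : DependsOn (fun w => g w / c) s :=
  fun _ _ h => by simp only [hg h]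

/-- Post-composition with any function (dot-notation extension of Mathlib's `DependsOn`). [folklore] -/
theorem _root_.DependsOn.comp_left (hg : DependsOn g s) (φ : ℝ → ℝ) : DependsOn (fun w => φ (g w)) s :=
  fun _ _ h => by simp only [hg h]

/-- Constants depend on any set. [folklore] -/
theorem dependsOn_const' (s : Set ι) (c : ℝ) : DependsOn (fun _ : ι → ℝ => c) s := fun _ _ _ => rfl

/-- **Derivatives inherit locality**: if `g` depends only on the coordinates in `s`, so does every
directional derivative `w ↦ Dg(w)·v` (no differentiability needed: translate and compare;
dot-notation extension of Mathlib's `DependsOn`, `ι` finite so that `ι → ℝ` is normed). [folklore] -/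
theorem _root_.DependsOn.fderiv_apply [Fintype ι] (hg : DependsOn g s) (v : ι → ℝ) :
    DependsOn (fun w => fderiv ℝ g w v) s := by
  intro w w' h
  have hfun : (fun u => g (u + w)) = fun u => g (u + w') := by
    funext u
    exact hg fun x hx => by simp [h x hx]
  have e1 : fderiv ℝ g w = fderiv ℝ (fun u => g (u + w)) 0 := by rw [fderiv_comp_add_right, zero_add]
  have e2 : fderiv ℝ g w' = fderiv ℝ (fun u => g (u + w')) 0 := by rw [fderiv_comp_add_right, zero_add]
  show fderiv ℝ g w v = fderiv ℝ g w' v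
  rw [e1, e2, hfun]

end Depends

namespace TrigTerm

section Balls

variable {x₀ : Fin m} {r : ℕ} {g : (Fin m → ℝ) → ℝ}

/-- Monotonicity of site balls. [folklore] -/
theorem siteBall_mono (x₀ : Fin m) {r r' : ℕ} (hrr' : r ≤ r') : siteBall x₀ r ⊆ siteBall x₀ r' :=
  fun _ hx => le_trans (mem_siteBall.1 hx) hrr'

/-- Re-anchoring: the ball of radius `r` around `x₀` lies in the ball of radius `d + r` around any
`x₁` with `dist(x₀, x₁) ≤ d`. [folklore] -/
theorem siteBall_anchor {x₁ : Fin m} {d : ℕ} (hd : Nat.dist x₀.val x₁.val ≤ d) :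
    siteBall x₀ r ⊆ siteBall x₁ (d + r) := by
  intro x hx
  rw [mem_siteBall] at hx ⊢
  have := Nat.dist.triangle_inequality x₁.val x₀.val x.val
  rw [Nat.dist_comm x₁.val x₀.val] at this
  omega

/-- The frequency `k·ω` of a mode vanishing outside the ball depends only on the ball. [folklore] -/
theorem dependsOn_modeFreq {k : Fin m → ℤ} (hk : ∀ x : Fin m, r < Nat.dist x₀.val x.val → k x = 0) :
    DependsOn (fun w => modeFreq k w) (siteBall x₀ r) := by
  intro w w' h
  unfold modeFreq modePhase
  refine sum_congr rfl fun x _ => ?_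
  by_cases hx : Nat.dist x₀.val x.val ≤ r
  · rw [h x (mem_siteBall.2 hx)]
  · rw [hk x (not_le.1 hx)]; simp

end Balls

/-! ### Support of the images of a term under the operators -/

variable {r : ℕ}

/-- Monotonicity of `SuppWithin` in the radius. [folklore] -/
theorem SuppWithin.mono {t : TrigTerm m} (ht : t.SuppWithin r) {r' : ℕ} (hrr' : r ≤ r') : t.SuppWithin r' :=
  ⟨fun x hx => ht.1 x (lt_of_le_of_lt hrr' hx),
    fun δ => ⟨(ht.2 δ).1.mono (siteBall_mono t.pos hrr'), (ht.2 δ).2.mono (siteBall_mono t.pos hrr')⟩⟩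

/-- Multiplication by a local multiplier keeps the support. [folklore] -/
theorem SuppWithin.smulFun {t : TrigTerm m} (ht : t.SuppWithin r) {θ : ℝ → (Fin m → ℝ) → ℝ}
    (hθ : ∀ δ, DependsOn (θ δ) (siteBall t.pos r)) : (t.smulFun θ).SuppWithin r :=
  ⟨ht.1, fun δ => ⟨(hθ δ).mul (ht.2 δ).1, (hθ δ).mul (ht.2 δ).2⟩⟩

/-- Negation keeps the support. [folklore] -/
theorem SuppWithin.neg {t : TrigTerm m} (ht : t.SuppWithin r) : t.neg.SuppWithin r :=
  ⟨ht.1, fun δ => ⟨(ht.2 δ).1.neg, (ht.2 δ).2.neg⟩⟩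

/-- `L_D` keeps the support. [cite: DeRoeckHuveneers2015, §3.3 ("`r(L_D⁻¹(Id - 𝓡)f) = r(f)`")] -/
theorem SuppWithin.bracketD {t : TrigTerm m} (ht : t.SuppWithin r) : t.bracketD.SuppWithin r :=
  ⟨ht.1, fun δ => ⟨(dependsOn_modeFreq ht.1).mul (ht.2 δ).2,
    ((dependsOn_modeFreq ht.1).mul (ht.2 δ).1).neg⟩⟩

/-- `𝓡` keeps the support. [cite: DeRoeckHuveneers2015, §3.3] -/
theorem SuppWithin.resCut {t : TrigTerm m} (ht : t.SuppWithin r) (ρ : ℝ → ℝ) : (t.resCut ρ).SuppWithin r :=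
  ht.smulFun fun δ => ((dependsOn_modeFreq ht.1).div_const δ).comp_left ρ

/-- `L_D⁻¹(Id - 𝓡)` keeps the support. [cite: DeRoeckHuveneers2015, §3.3 ("`r(L_D⁻¹(Id - 𝓡)f) = r(f)`")] -/
theorem SuppWithin.solve {t : TrigTerm m} (ht : t.SuppWithin r) (ρ : ℝ → ℝ) : (t.solve ρ).SuppWithin r := by
  have hc : ∀ δ, DependsOn (fun w => cutDiv ρ δ (modeFreq t.mode w)) (siteBall t.pos r) :=
    fun δ => (dependsOn_modeFreq ht.1).comp_left (cutDiv ρ δ)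
  exact ⟨ht.1, fun δ => ⟨((hc δ).mul (ht.2 δ).2).neg, (hc δ).mul (ht.2 δ).1⟩⟩

/-- **The bracket raises the support radius to `r' + 2r`** ("`r(L_g f) ≤ 2 r(g) + r(f)`"): for
`t` supported within `r`, `t'` within `r'`, anchors at distance `≤ r + r'`, every term of
`bracket t t'` (anchored at the anchor of `t'`) is supported within `r' + 2r`.
[cite: DeRoeckHuveneers2015, §3.3 proof of (3.11)] -/
theorem SuppWithin.bracket {t t' : TrigTerm m} {r' : ℕ} (ht : t.SuppWithin r) (ht' : t'.SuppWithin r')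
    (hd : Nat.dist t.pos.val t'.pos.val ≤ r + r') {s : TrigTerm m} (hs : s ∈ t.bracket t') :
    s.SuppWithin (r' + 2 * r) := by
  -- everything from `t` re-anchored at `t'.pos`
  have hsub : siteBall t.pos r ⊆ siteBall t'.pos (r' + 2 * r) :=
    (siteBall_anchor hd).trans (siteBall_mono t'.pos (by omega))
  have hsub' : siteBall t'.pos r' ⊆ siteBall t'.pos (r' + 2 * r) := siteBall_mono t'.pos (by omega)
  have hta : ∀ δ, DependsOn (t.cosCoeff δ) (siteBall t'.pos (r' + 2 * r)) ∧
      DependsOn (t.sinCoeff δ) (siteBall t'.pos (r' + 2 * r)) := fun δ =>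
    ⟨(ht.2 δ).1.mono hsub, (ht.2 δ).2.mono hsub⟩
  have ht'a : ∀ δ, DependsOn (t'.cosCoeff δ) (siteBall t'.pos (r' + 2 * r)) ∧
      DependsOn (t'.sinCoeff δ) (siteBall t'.pos (r' + 2 * r)) := fun δ =>
    ⟨(ht'.2 δ).1.mono hsub', (ht'.2 δ).2.mono hsub'⟩
  have hmode : ∀ x : Fin m, r' + 2 * r < Nat.dist t'.pos.val x.val → t.mode x = 0 ∧ t'.mode x = 0 := by
    intro x hx
    refine ⟨ht.1 x ?_, ht'.1 x (by omega)⟩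
    have := Nat.dist.triangle_inequality t'.pos.val t.pos.val x.val
    rw [Nat.dist_comm t'.pos.val t.pos.val] at this
    omega
  simp only [TrigTerm.bracket, List.mem_cons, List.mem_nil_iff, or_false] at hs
  rcases hs with rfl | rfl
  · refine ⟨fun x hx => by simp [(hmode x hx).1, (hmode x hx).2], fun δ => ⟨?_, ?_⟩⟩
    · exact (((((hta δ).1.fderiv_apply _).mul (ht'a δ).2).add (((hta δ).2.fderiv_apply _).mul (ht'a δ).1)).sub
        ((hta δ).1.mul ((ht'a δ).2.fderiv_apply _)) |>.sub ((hta δ).2.mul ((ht'a δ).1.fderiv_apply _))).div_const 2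
    · exact (((((hta δ).1.fderiv_apply _).mul (ht'a δ).1).neg.add (((hta δ).2.fderiv_apply _).mul (ht'a δ).2)).add
        ((hta δ).1.mul ((ht'a δ).1.fderiv_apply _)) |>.sub ((hta δ).2.mul ((ht'a δ).2.fderiv_apply _))).div_const 2
  · refine ⟨fun x hx => by simp [(hmode x hx).1, (hmode x hx).2], fun δ => ⟨?_, ?_⟩⟩
    · exact (((((hta δ).1.fderiv_apply _).mul (ht'a δ).2).sub (((hta δ).2.fderiv_apply _).mul (ht'a δ).1)).add
        ((hta δ).1.mul ((ht'a δ).2.fderiv_apply _)) |>.sub ((hta δ).2.mul ((ht'a δ).1.fderiv_apply _))).div_const 2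
    · exact (((((hta δ).1.fderiv_apply _).mul (ht'a δ).1).add (((hta δ).2.fderiv_apply _).mul (ht'a δ).2)).add
        ((hta δ).1.mul ((ht'a δ).1.fderiv_apply _)) |>.add ((hta δ).2.mul ((ht'a δ).2.fderiv_apply _))).div_const 2

/-! ### Smoothness of the coefficients at a scale -/

/-- Both coefficients of a term are smooth at scale `δ`. [folklore] -/
def SmoothAt (t : TrigTerm m) (δ : ℝ) : Prop := ContDiff ℝ ∞ (t.cosCoeff δ) ∧ ContDiff ℝ ∞ (t.sinCoeff δ)

/-- The frequency `ω ↦ k·ω` is smooth. [folklore] -/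
theorem contDiff_modeFreq (k : Fin m → ℤ) {n : WithTop ℕ∞} : ContDiff ℝ n fun w : Fin m → ℝ => modeFreq k w := by
  unfold modeFreq modePhase
  exact ContDiff.sum fun x _ => contDiff_const.mul (contDiff_apply ℝ ℝ x)

/-- The divided cut-off `s ↦ (1 - ρ(s/δ))/s` is smooth when `ρ` is smooth and `ρ = 1` near `0`
(for every `δ`; Lean's `s/0 = 0` makes it the zero function at `δ = 0`). [cite: DeRoeckHuveneers2015, §3.1 ("can be solved in `𝒮(Ω)`")] -/
theorem contDiff_cutDiv {ρ : ℝ → ℝ} (hρ : ContDiff ℝ ∞ ρ) (h1 : ∀ᶠ s in 𝓝 (0 : ℝ), ρ s = 1) (δ : ℝ) :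
    ContDiff ℝ ∞ (cutDiv ρ δ) := by
  refine contDiff_iff_contDiffAt.2 fun s => ?_
  rcases eq_or_ne s 0 with rfl | hs
  · -- locally zero near `0`
    have hev : ∀ᶠ s in 𝓝 (0 : ℝ), cutDiv ρ δ s = 0 := by
      have hmap : Tendsto (fun s : ℝ => s / δ) (𝓝 0) (𝓝 0) := by
        have := (continuous_id.div_const δ).tendsto (0 : ℝ)
        simpa using this
      filter_upwards [hmap.eventually h1] with s hs
      simp [cutDiv, hs]
    exact (contDiffAt_const (c := (0 : ℝ))).congr_of_eventuallyEq hev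
  · have hnum : ContDiffAt ℝ ∞ (fun s => 1 - ρ (s / δ)) s :=
      (contDiff_const.sub (hρ.comp (contDiff_id.div_const δ))).contDiffAt
    exact hnum.div contDiffAt_id hs

/-- Smoothness is kept by a smooth multiplier. [folklore] -/
theorem SmoothAt.smulFun {t : TrigTerm m} {δ : ℝ} (ht : t.SmoothAt δ) {θ : ℝ → (Fin m → ℝ) → ℝ}
    (hθ : ContDiff ℝ ∞ (θ δ)) : (t.smulFun θ).SmoothAt δ :=
  ⟨hθ.mul ht.1, hθ.mul ht.2⟩

/-- Smoothness is kept by negation. [folklore] -/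
theorem SmoothAt.neg {t : TrigTerm m} {δ : ℝ} (ht : t.SmoothAt δ) : t.neg.SmoothAt δ := ⟨ht.1.neg, ht.2.neg⟩

/-- Smoothness is kept by `L_D`. [folklore] -/
theorem SmoothAt.bracketD {t : TrigTerm m} {δ : ℝ} (ht : t.SmoothAt δ) : t.bracketD.SmoothAt δ :=
  ⟨(contDiff_modeFreq t.mode).mul ht.2, ((contDiff_modeFreq t.mode).mul ht.1).neg⟩

/-- Smoothness is kept by `𝓡` (`ρ` smooth). [folklore] -/
theorem SmoothAt.resCut {t : TrigTerm m} {δ : ℝ} (ht : t.SmoothAt δ) {ρ : ℝ → ℝ} (hρ : ContDiff ℝ ∞ ρ) :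
    (t.resCut ρ).SmoothAt δ :=
  ht.smulFun (hρ.comp ((contDiff_modeFreq t.mode).div_const δ))

/-- Smoothness is kept by `L_D⁻¹(Id - 𝓡)` (`ρ` smooth, `= 1` near `0`). [folklore] -/
theorem SmoothAt.solve {t : TrigTerm m} {δ : ℝ} (ht : t.SmoothAt δ) {ρ : ℝ → ℝ} (hρ : ContDiff ℝ ∞ ρ)
    (h1 : ∀ᶠ s in 𝓝 (0 : ℝ), ρ s = 1) : (t.solve ρ).SmoothAt δ := by
  have hc : ContDiff ℝ ∞ fun w : Fin m → ℝ => cutDiv ρ δ (modeFreq t.mode w) :=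
    (contDiff_cutDiv hρ h1 δ).comp (contDiff_modeFreq t.mode)
  exact ⟨(hc.mul ht.2).neg, hc.mul ht.1⟩

/-- Directional derivatives of smooth coefficient families are smooth. [folklore] -/
theorem contDiff_dirDeriv {c : ℝ → (Fin m → ℝ) → ℝ} {δ : ℝ} (hc : ContDiff ℝ ∞ (c δ)) (k : Fin m → ℤ) :
    ContDiff ℝ ∞ (dirDeriv k c δ) := by
  unfold dirDeriv
  exact (hc.fderiv_right (m := ∞) (by simp)).clm_apply contDiff_const

/-- Smoothness is kept by the bracket. [folklore] -/
theorem SmoothAt.bracket {t t' : TrigTerm m} {δ : ℝ} (ht : t.SmoothAt δ) (ht' : t'.SmoothAt δ)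
    {s : TrigTerm m} (hs : s ∈ t.bracket t') : s.SmoothAt δ := by
  have hA := contDiff_dirDeriv ht.1 t'.mode
  have hB := contDiff_dirDeriv ht.2 t'.mode
  have hA' := contDiff_dirDeriv ht'.1 t.mode
  have hB' := contDiff_dirDeriv ht'.2 t.mode
  simp only [TrigTerm.bracket, List.mem_cons, List.mem_nil_iff, or_false] at hs
  rcases hs with rfl | rfl
  · exact ⟨((((hA.mul ht'.2).add (hB.mul ht'.1)).sub (ht.1.mul hB')).sub (ht.2.mul hA')).div_const 2,
      ((((hA.mul ht'.1).neg.add (hB.mul ht'.2)).add (ht.1.mul hA')).sub (ht.2.mul hB')).div_const 2⟩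
  · exact ⟨((((hA.mul ht'.2).sub (hB.mul ht'.1)).add (ht.1.mul hB')).sub (ht.2.mul hA')).div_const 2,
      ((((hA.mul ht'.1).add (hB.mul ht'.2)).add (ht.1.mul hA')).add (ht.2.mul hB')).div_const 2⟩

/-- Smooth coefficients are differentiable. [folklore] -/
theorem SmoothAt.differentiable {t : TrigTerm m} {δ : ℝ} (ht : t.SmoothAt δ) :
    Differentiable ℝ (t.cosCoeff δ) ∧ Differentiable ℝ (t.sinCoeff δ) :=
  ⟨ht.1.differentiable (by simp), ht.2.differentiable (by simp)⟩

end TrigTerm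

namespace TrigPoly

/-! ### Polynomial versions -/

/-- All terms supported within `r` of their anchors. [cite: DeRoeckHuveneers2015, §3.1 (3.2)] -/
def SuppWithinAll (F : TrigPoly m) (r : ℕ) : Prop := ∀ t ∈ F, t.SuppWithin r

/-- All coefficients smooth at scale `δ`. [folklore] -/
def SmoothAt (F : TrigPoly m) (δ : ℝ) : Prop := ∀ t ∈ F, t.SmoothAt δ

/-- **Good** at radius `r` and scale `δ`: local and smooth (the standing hypothesis of the symbolic
calculus). [folklore] -/
def Good (F : TrigPoly m) (r : ℕ) (δ : ℝ) : Prop := F.SuppWithinAll r ∧ F.SmoothAt δ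

variable {F G : TrigPoly m} {r r' : ℕ} {δ : ℝ}

/-- Good polynomials are admissible for `poisson_ev_ev`. [folklore] -/
theorem Good.admissible (h : F.Good r δ) : F.Admissible r δ :=
  fun t ht => ⟨h.1 t ht, (h.2 t ht).differentiable⟩

/-- Monotonicity in the radius. [folklore] -/
theorem Good.mono (h : F.Good r δ) {r'' : ℕ} (hr : r ≤ r'') : F.Good r'' δ :=
  ⟨fun t ht => (h.1 t ht).mono hr, h.2⟩

/-- The empty polynomial is good. [folklore] -/
theorem good_nil (r : ℕ) (δ : ℝ) : Good ([] : TrigPoly m) r δ := ⟨fun _ h => by simp at h, fun _ h => by simp at h⟩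

/-- Concatenation of good polynomials. [folklore] -/
theorem Good.append (hF : F.Good r δ) (hG : G.Good r δ) : Good (F ++ G) r δ :=
  ⟨fun t ht => by rcases List.mem_append.1 ht with h | h; exacts [hF.1 t h, hG.1 t h],
    fun t ht => by rcases List.mem_append.1 ht with h | h; exacts [hF.2 t h, hG.2 t h]⟩

/-- A flat-map of good polynomials is good. [folklore] -/
theorem good_flatMap {α : Type*} {l : List α} {f : α → TrigPoly m} (h : ∀ a ∈ l, (f a).Good r δ) :
    Good (l.flatMap f) r δ :=
  ⟨fun t ht => by
      obtain ⟨a, ha, hta⟩ := List.mem_flatMap.1 ht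
      exact (h a ha).1 t hta,
    fun t ht => by
      obtain ⟨a, ha, hta⟩ := List.mem_flatMap.1 ht
      exact (h a ha).2 t hta⟩

/-- Local smooth multipliers keep goodness (multiplier local w.r.t. every anchor of `F`). [folklore] -/
theorem Good.smulFun (h : F.Good r δ) {θ : ℝ → (Fin m → ℝ) → ℝ}
    (hθl : ∀ t ∈ F, ∀ δ', DependsOn (θ δ') (siteBall t.pos r)) (hθs : ContDiff ℝ ∞ (θ δ)) :
    Good (TrigPoly.smulFun θ F) r δ := by
  refine ⟨fun s hs => ?_, fun s hs => ?_⟩ <;> obtain ⟨t, ht, rfl⟩ := List.mem_map.1 hs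
  · exact (h.1 t ht).smulFun (hθl t ht)
  · exact (h.2 t ht).smulFun hθs

/-- Real multiples keep goodness. [folklore] -/
theorem Good.constSMul (h : F.Good r δ) (c : ℝ) : Good (TrigPoly.constSMul c F) r δ :=
  h.smulFun (fun t _ _ => dependsOn_const' (siteBall t.pos r) c) contDiff_const

/-- Negation keeps goodness. [folklore] -/
theorem Good.neg (h : F.Good r δ) : Good (TrigPoly.neg F) r δ := by
  refine ⟨fun s hs => ?_, fun s hs => ?_⟩ <;> obtain ⟨t, ht, rfl⟩ := List.mem_map.1 hs
  · exact (h.1 t ht).neg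
  · exact (h.2 t ht).neg

/-- `L_D` keeps goodness. [folklore] -/
theorem Good.bracketD (h : F.Good r δ) : Good (TrigPoly.bracketD F) r δ := by
  refine ⟨fun s hs => ?_, fun s hs => ?_⟩ <;> obtain ⟨t, ht, rfl⟩ := List.mem_map.1 hs
  · exact (h.1 t ht).bracketD
  · exact (h.2 t ht).bracketD

/-- `𝓡` keeps goodness. [folklore] -/
theorem Good.resCut (h : F.Good r δ) {ρ : ℝ → ℝ} (hρ : ContDiff ℝ ∞ ρ) : Good (TrigPoly.resCut ρ F) r δ := by
  refine ⟨fun s hs => ?_, fun s hs => ?_⟩ <;> obtain ⟨t, ht, rfl⟩ := List.mem_map.1 hs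
  · exact (h.1 t ht).resCut ρ
  · exact (h.2 t ht).resCut hρ

/-- `L_D⁻¹(Id - 𝓡)` keeps goodness. [folklore] -/
theorem Good.solve (h : F.Good r δ) {ρ : ℝ → ℝ} (hρ : ContDiff ℝ ∞ ρ) (h1 : ∀ᶠ s in 𝓝 (0 : ℝ), ρ s = 1) :
    Good (TrigPoly.solve ρ F) r δ := by
  refine ⟨fun s hs => ?_, fun s hs => ?_⟩ <;> obtain ⟨t, ht, rfl⟩ := List.mem_map.1 hs
  · exact (h.1 t ht).solve ρ
  · exact (h.2 t ht).solve hρ h1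

/-- **The bracket of good polynomials is good, with radius `r' + 2r`.** [cite: DeRoeckHuveneers2015, §3.3 proof of (3.11)] -/
theorem Good.bracket (hF : F.Good r δ) (hG : G.Good r' δ) : Good (TrigPoly.bracket r r' F G) (r' + 2 * r) δ := by
  refine good_flatMap fun t ht => good_flatMap fun t' ht' => ?_
  by_cases hd : Nat.dist t.pos.val t'.pos.val ≤ r + r'
  · rw [if_pos hd]
    exact ⟨fun s hs => (hF.1 t ht).bracket (hG.1 t' ht') hd hs, fun s hs => (hF.2 t ht).bracket (hG.2 t' ht') hs⟩
  · rw [if_neg hd]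
    exact good_nil _ _

/-- **`{ev F, ev G} = ev (bracket r r' F G)` for good polynomials.** [cite: DeRoeckHuveneers2015, §3.3] -/
theorem Good.poisson_ev_ev (hF : F.Good r δ) (hG : G.Good r' δ) (z : PhaseSpace m) :
    poisson (ev F δ) (ev G δ) z = ev (TrigPoly.bracket r r' F G) δ z :=
  TrigPoly.poisson_ev_ev hF.admissible hG.admissible z

/-- Good polynomials evaluate to smooth functions. [folklore] -/
theorem Good.contDiff_ev (h : F.Good r δ) : ContDiff ℝ ∞ (ev F δ) :=
  TrigPoly.contDiff_ev F fun t ht => h.2 t ht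

end TrigPoly

end Literature.MathematicalPhysics.KineticTheory.HeatConduction

end
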